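import Literature.Barriers.QuantumAdvantage.RandomOracleMethodThm23
import Literature.Computability.QuantumComplexity.AaronsonAmbainisThm23Machine
import HarnessLib

/-!
# The random oracle method barrier, discharged: `RandomOracleMethod_holds`

`RandomOracleMethod` (`RandomOracleMethod.lean`) is the conjunction of
[Fortnow–Rogers 1999, Thm. 4.4] (`fortnowRogers1999_thm44`, proved in
`RandomOracleMethodProofs.lean`) and [Aaronson–Ambainis 2014, Thm. 7 (iii) = Thm. 23]
(`aaronsonAmbainis2014_thm7iii`). `RandomOracleMethodThm23.lean` reduced the latter
(`randomOracleMethod_of_dyadicMachines`) to the single machine hypothesis of the printed proof of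
Thm. 23 — the polynomial-time implementability, under `P = P^{#P}`, of the classical simulation
trees with `poly(n)` queries (p. 14: "we can implement `C` using not only `poly(n)` queries to
`A`, but also `poly(n)` computation steps") — and that hypothesis is the theorem
`thm23_dyadicMachines` of `QuantumComplexity/AaronsonAmbainisThm23Machine.lean` (the end of the
machine-level series `GuessedOracleRuns` → `AaronsonAmbainisMoments` → `…Thm23Atoms` →
`…Thm23Formulas` → `…Thm23Semantics*` → `…Thm23Tests` → `…Thm23Generator*` → `…Thm23Machine`).
Hence:

* `aaronsonAmbainis2014_thm7iii_holds : aaronsonAmbainis2014_thm7iii`;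
* **`RandomOracleMethod_holds : RandomOracleMethod`**.

## References

* L. Fortnow, J. Rogers, *Complexity limitations on quantum computation*, J. Comput. System Sci.
  59 (1999) 240–252, Thm. 4.4 [FortnowRogers1999JCSS].
* S. Aaronson, A. Ambainis, *The need for structure in quantum speedups*, Theory Comput. 10
  (2014) 133–166, Thm. 7 (iii), Thm. 23 and its proof (arXiv:0911.0996v3, p. 14)
  [AaronsonAmbainis2014].
* C. H. Bennett, J. Gill, *Relative to a random oracle `A`, `P^A ≠ NP^A ≠ coNP^A` with
  probability 1*, SIAM J. Comput. 10 (1981), Thm. 5.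
-/

noncomputable section

namespace Literature.Barriers.QuantumAdvantage

open Literature.Computability.QuantumComplexity

/-- **[AA14, Thm. 7 (iii)] holds**: the AA conjecture implies
`P = P^{#P} → BQP^A ⊂ AvgP^A` with probability `1` for a random oracle `A`. [cite: AaronsonAmbainis2014, Thm. 7 (iii), Thm. 23] -/
theorem aaronsonAmbainis2014_thm7iii_holds : aaronsonAmbainis2014_thm7iii :=
  aaronsonAmbainis2014_thm7iii_of_dyadicMachines fun c k h hP F hU => thm23_dyadicMachines c k h hP F hU

/-- **The random oracle method barrier holds**: [Fortnow–Rogers 1999, Thm. 4.4] and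
[Aaronson–Ambainis 2014, Thm. 7 (iii)]. [cite: FortnowRogers1999JCSS, Thm. 4.4] [cite: AaronsonAmbainis2014, Thm. 7 (iii)] -/
theorem RandomOracleMethod_holds : RandomOracleMethod :=
  randomOracleMethod_of_dyadicMachines fun c k h hP F hU => thm23_dyadicMachines c k h hP F hU

end Literature.Barriers.QuantumAdvantage

end
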